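import Summits.CriticalPhenomena.PercolationContinuityZ3.Theorems.FK.DomainMarkovToolkit
import Literature.Probability.Percolation.SharpnessDCTProofs
import HarnessLib

/-!
# FK-continuity transplant, FO-10 (domain-Markov toolkit, seat A): events defined through open paths — the
# lattice-support adapter for the free/wired sandwich and for extremality, and the one-arm events `{0 ↔ ∂Λ_n}`

Cell `fk-continuity` (bschramm), row FO-10a; support file for the FK-continuity transplant
(`--supports stmt-CriticalPhenomena-4575`); builds on p205010 (kernel theorem, internal audit signed; external
expert review pending).  Pure proofs; no definitions, no named facts, no sorries.

## Why an adapter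

The cell's interface `FKGibbs` (FO-06a) and the extremality theorems of `DomainMarkovToolkit.lean` ask the fresh
event `A` to be `DeterminedBy A ↑(edgesIn (zdGraph d) Λ)` — determined by the LATTICE EDGES inside the region `Λ`.
The tree's connection events, however, are phrased through `openGraph ω = fromEdgeSet ω` for an arbitrary set of
pairs `ω` (`openConn`, `openConnIn`, `siteToBoundary`, the Kozma–Nitzan events), so they are determined by ALL PAIRS
of the region, `DeterminedBy A ↑(Λ.sym2)` (e.g. the tree's `DCT16.determinedBy_siteToBoundary`), and a configuration
containing a non-lattice pair can lie in `{0 ↔ ∂Λ_n}` without any open lattice path.  Every measure of the cell is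
carried by lattice configurations (`FKGibbs.ae_subset_edgeSet`, FO-06b `IsBoxLimit.ae_subset_edgeSet`), so the
discrepancy is null: this file packages the passage through the lattice part `ω ↦ ω ∩ E(ℤ^d)` once and for all.

## Contents

* `inter_edgeSet_inter_coe_sym2` (`(ω ∩ E) ∩ Λ.sym2 = ω ∩ E_Λ`), `determinedBy_preimage_inter_edgeSet` (an event
  determined by `Λ.sym2` has lattice part `(· ∩ E) ⁻¹' A` determined by `E_Λ`), monotonicity of the lattice part,
  `measureReal_preimage_inter_edgeSet` (under a lattice-carried measure the lattice part has the same mass),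
  `liftEdges_subset_edgeSet` / `rcMeasure_region_real_preimage_inter_edgeSet` (the region laws `φ^W_{Λ,p,q}` do not
  see the difference either).
* The sandwich for events determined by ALL PAIRS of a region: `FKGibbs.free_mul_le_of_determinedBy_sym2`,
  `FKGibbs.le_wired_mul_of_determinedBy_sym2` (increasing), `FKGibbs.le_free_mul_of_isLowerSet_of_determinedBy_sym2`,
  `FKGibbs.wired_mul_le_of_isLowerSet_of_determinedBy_sym2` (decreasing).
* Extremality for such events: `FKGibbs.isBoxLimit_real_le_of_determinedBy_sym2` (`φ⁰_{p,q}(A) ≤ P(A)`),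
  `FKGibbs.real_le_isBoxLimit_of_determinedBy_sym2` (`P(A) ≤ φ¹_{p,q}(A)`), given that the box limit is carried by
  lattice configurations (FO-06b `IsBoxLimit.ae_subset_edgeSet`).
* The one-arm events: `FKGibbs.isBoxLimit_real_siteToBoundary_le`, `FKGibbs.real_siteToBoundary_le_isBoxLimit`
  (`φ⁰_{p,q}(0 ↔ ∂Λ_n) ≤ P(0 ↔ ∂Λ_n) ≤ φ¹_{p,q}(0 ↔ ∂Λ_n)` for every `P` of the sandwich class — Grimmett 2006,
  (4.21)/(4.35) on the events whose limits are `θ⁰`, `θ¹` (FO-07's identification)).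

## References

* G. Grimmett, *The Random-Cluster Model*, Springer 2006: §4.1 (the measurable structure), Lemma (4.13) p. 70,
  Lemma (4.14)(b) p. 71, Thm. (4.19)(c) eq. (4.21) p. 76, Thm. (4.34)(b) eq. (4.35) p. 81, §5.1 (5.1)–(5.3)
  (`θ^b` as the limit of `φ^b_{p,q}(0 ↔ ∂Λ_n)`). [Grimmett2006]
-/

noncomputable section

open MeasureTheory Set Filter
open scoped Topology ENNReal

namespace Summit.CriticalPhenomena.PercolationContinuityZ3.Theorems.FK

open Literature.Probability.Percolation Literature.Probability.LatticeModels

variable {d : ℕ}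

/-! ### The lattice part `ω ∩ E(ℤ^d)` of a configuration -/

section LatticePart

/-- `(ω ∩ E(ℤ^d)) ∩ Λ.sym2 = ω ∩ E_Λ`: the lattice pairs of `Λ` are exactly `E_Λ = edgesIn (zdGraph d) Λ`.
[cite: Grimmett2006, §4.2 (E_Λ)] -/
theorem inter_edgeSet_inter_coe_sym2 (ω : BondConfig (Site d)) (Λ : Finset (Site d)) :
    ω ∩ (zdGraph d).edgeSet ∩ (↑(Λ.sym2) : Set (Sym2 (Site d))) = ω ∩ ↑(edgesIn (zdGraph d) Λ) := by
  ext e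
  simp only [Set.mem_inter_iff, Finset.mem_coe, Finset.mem_sym2_iff, mem_edgesIn_iff, and_assoc]

/-- An event determined by all pairs of `Λ` has its LATTICE PART `{ω | ω ∩ E(ℤ^d) ∈ A}` determined by `E_Λ`.
[cite: Grimmett2006, §4.1] -/
theorem determinedBy_preimage_inter_edgeSet {A : Set (BondConfig (Site d))} {Λ : Finset (Site d)}
    (hA : DeterminedBy A ↑(Λ.sym2)) :
    DeterminedBy ((fun ω => ω ∩ (zdGraph d).edgeSet) ⁻¹' A) ↑(edgesIn (zdGraph d) Λ) := by
  rw [determinedBy_iff] at hA ⊢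
  intro ω ω' h
  simp only [Set.mem_preimage]
  refine hA _ _ ?_
  rw [inter_edgeSet_inter_coe_sym2, inter_edgeSet_inter_coe_sym2, h]

/-- The lattice part of an increasing event is increasing. [folklore] -/
theorem isUpperSet_preimage_inter_edgeSet {A : Set (BondConfig (Site d))} (hA : IsUpperSet A) :
    IsUpperSet ((fun ω => ω ∩ (zdGraph d).edgeSet) ⁻¹' A) :=
  fun _ _ hle hω => hA (Set.inter_subset_inter_left _ hle) hω

/-- The lattice part of a decreasing event is decreasing. [folklore] -/
theorem isLowerSet_preimage_inter_edgeSet {A : Set (BondConfig (Site d))} (hA : IsLowerSet A) :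
    IsLowerSet ((fun ω => ω ∩ (zdGraph d).edgeSet) ⁻¹' A) :=
  fun _ _ hle hω => hA (Set.inter_subset_inter_left _ hle) hω

/-- Under a measure carried by lattice configurations an event and its lattice part have the same mass.
[cite: Grimmett2006, §4.1] -/
theorem measureReal_preimage_inter_edgeSet {μ : Measure (BondConfig (Site d))}
    (hμ : ∀ᵐ ω ∂μ, ω ⊆ (zdGraph d).edgeSet) (A : Set (BondConfig (Site d))) :
    μ.real ((fun ω => ω ∩ (zdGraph d).edgeSet) ⁻¹' A) = μ.real A := by
  refine measureReal_congr (hμ.mono fun ω hω => ?_)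
  show (ω ∩ (zdGraph d).edgeSet ∈ A) = (ω ∈ A)
  rw [Set.inter_eq_self_of_subset_left hω]

/-- The same intersected with a second event (a history). [cite: Grimmett2006, §4.1] -/
theorem measureReal_preimage_inter_edgeSet_inter {μ : Measure (BondConfig (Site d))}
    (hμ : ∀ᵐ ω ∂μ, ω ⊆ (zdGraph d).edgeSet) (A H : Set (BondConfig (Site d))) :
    μ.real ((fun ω => ω ∩ (zdGraph d).edgeSet) ⁻¹' A ∩ H) = μ.real (A ∩ H) := by
  refine measureReal_congr (hμ.mono fun ω hω => ?_)
  show (ω ∩ (zdGraph d).edgeSet ∈ A ∧ ω ∈ H) = (ω ∈ A ∧ ω ∈ H)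
  rw [Set.inter_eq_self_of_subset_left hω]

/-- A lifted configuration of the edges of a finite piece of `ℤ^d` consists of lattice edges. [cite: Grimmett2006, §4.2] -/
theorem liftEdges_subset_edgeSet {Λ : Finset (Site d)} {ω : BondConfig ↥Λ}
    (hω : ω ⊆ (finsetGraph (zdGraph d) Λ).edgeSet) : liftEdges Λ ω ⊆ (zdGraph d).edgeSet := by
  rintro _ ⟨e', he', rfl⟩
  have h := hω he'
  induction e' using Sym2.ind with
  | h a b =>
    rw [SimpleGraph.mem_edgeSet, finsetGraph_adj_iff] at h
    rw [Sym2.map_mk, SimpleGraph.mem_edgeSet]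
    exact h

/-- The region laws `φ^W_{Λ,p,q}` do not see the difference between an event and its lattice part (the
random-cluster measure of `(Λ, E_Λ)` lives on lattice configurations). [cite: Grimmett2006, §1.2 eq. (1.2)] -/
theorem rcMeasure_region_real_preimage_inter_edgeSet {p q : ℝ} (hp : p ∈ Set.Icc (0 : ℝ) 1) (hq : 0 < q)
    (Λ : Finset (Site d)) (W : Set ↥Λ) (A : Set (BondConfig (Site d))) :
    (rcMeasure (finsetGraph (zdGraph d) Λ) p q W).real
        (liftEdges Λ ⁻¹' ((fun ω => ω ∩ (zdGraph d).edgeSet) ⁻¹' A)) =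
      (rcMeasure (finsetGraph (zdGraph d) Λ) p q W).real (liftEdges Λ ⁻¹' A) := by
  refine le_antisymm ?_ ?_
  · refine rcMeasure_real_mono_on_edgeSets _ hp hq W fun ω hωE hω => ?_
    rw [Set.mem_preimage, Set.mem_preimage, Set.inter_eq_self_of_subset_left (liftEdges_subset_edgeSet hωE)] at hω
    exact hω
  · refine rcMeasure_real_mono_on_edgeSets _ hp hq W fun ω hωE hω => ?_
    rw [Set.mem_preimage, Set.mem_preimage, Set.inter_eq_self_of_subset_left (liftEdges_subset_edgeSet hωE)]
    exact hω

/-- In particular for the free region law `φ⁰_{Λ,p,q}`. [cite: Grimmett2006, §4.2 (4.11)–(4.12)] -/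
theorem regionFreeReal_preimage_inter_edgeSet {p q : ℝ} (hp : p ∈ Set.Icc (0 : ℝ) 1) (hq : 0 < q)
    (Λ : Finset (Site d)) (A : Set (BondConfig (Site d))) :
    regionFreeReal d p q Λ ((fun ω => ω ∩ (zdGraph d).edgeSet) ⁻¹' A) = regionFreeReal d p q Λ A :=
  rcMeasure_region_real_preimage_inter_edgeSet hp hq Λ ∅ A

/-- In particular for the wired region law `φ¹_{Λ,p,q}`. [cite: Grimmett2006, §4.2 (4.11)–(4.12)] -/
theorem regionWiredReal_preimage_inter_edgeSet {p q : ℝ} (hp : p ∈ Set.Icc (0 : ℝ) 1) (hq : 0 < q)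
    (Λ : Finset (Site d)) (A : Set (BondConfig (Site d))) :
    regionWiredReal d p q Λ ((fun ω => ω ∩ (zdGraph d).edgeSet) ⁻¹' A) = regionWiredReal d p q Λ A :=
  rcMeasure_region_real_preimage_inter_edgeSet hp hq Λ (wiredBoundary (zdGraph d) Λ) A

end LatticePart

/-! ### The sandwich for events determined by all pairs of a region -/

namespace FKGibbs

variable {p q : ℝ} {P P₀ P₁ : Measure (BondConfig (Site d))}

/-- Lower sandwich for an increasing event determined by ALL PAIRS of `Λ` (e.g. the tree's open-path events):
`φ⁰_{Λ,p,q}(A) · P(H) ≤ P(A ∩ H)`. [cite: Grimmett2006, Lemma (4.13) and Lemma (4.14)(b)] -/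
theorem free_mul_le_of_determinedBy_sym2 (hP : FKGibbs d p q P) (hp : p ∈ Set.Icc (0 : ℝ) 1) (hq : 0 < q)
    (Λ : Finset (Site d)) {A H : Set (BondConfig (Site d))} (T : Finset (Sym2 (Site d))) (hA : IsUpperSet A)
    (hAΛ : DeterminedBy A ↑(Λ.sym2)) (hT : Disjoint (↑T : Set (Sym2 (Site d))) ↑(edgesIn (zdGraph d) Λ))
    (hH : DeterminedBy H ↑T) : regionFreeReal d p q Λ A * P.real H ≤ P.real (A ∩ H) := by
  have h := hP.free_mul_le Λ T (isUpperSet_preimage_inter_edgeSet hA) (determinedBy_preimage_inter_edgeSet hAΛ) hT hH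
  rwa [regionFreeReal_preimage_inter_edgeSet hp hq,
    measureReal_preimage_inter_edgeSet_inter hP.ae_subset_edgeSet] at h

/-- Upper sandwich for an increasing event determined by all pairs of `Λ`: `P(A ∩ H) ≤ φ¹_{Λ,p,q}(A) · P(H)`.
[cite: Grimmett2006, Lemma (4.13) and Lemma (4.14)(b)] -/
theorem le_wired_mul_of_determinedBy_sym2 (hP : FKGibbs d p q P) (hp : p ∈ Set.Icc (0 : ℝ) 1) (hq : 0 < q)
    (Λ : Finset (Site d)) {A H : Set (BondConfig (Site d))} (T : Finset (Sym2 (Site d))) (hA : IsUpperSet A)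
    (hAΛ : DeterminedBy A ↑(Λ.sym2)) (hT : Disjoint (↑T : Set (Sym2 (Site d))) ↑(edgesIn (zdGraph d) Λ))
    (hH : DeterminedBy H ↑T) : P.real (A ∩ H) ≤ regionWiredReal d p q Λ A * P.real H := by
  have h := hP.le_wired_mul Λ T (isUpperSet_preimage_inter_edgeSet hA) (determinedBy_preimage_inter_edgeSet hAΛ) hT hH
  rwa [regionWiredReal_preimage_inter_edgeSet hp hq,
    measureReal_preimage_inter_edgeSet_inter hP.ae_subset_edgeSet] at h

/-- Decreasing event determined by all pairs of `Λ`, from above: `P(D ∩ H) ≤ φ⁰_{Λ,p,q}(D) · P(H)`.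
[cite: Grimmett2006, Lemma (4.13) and Lemma (4.14)(b)] -/
theorem le_free_mul_of_isLowerSet_of_determinedBy_sym2 (hP : FKGibbs d p q P) (hp : p ∈ Set.Icc (0 : ℝ) 1)
    (hq : 0 < q) (Λ : Finset (Site d)) {D H : Set (BondConfig (Site d))} (T : Finset (Sym2 (Site d)))
    (hD : IsLowerSet D) (hDΛ : DeterminedBy D ↑(Λ.sym2))
    (hT : Disjoint (↑T : Set (Sym2 (Site d))) ↑(edgesIn (zdGraph d) Λ)) (hH : DeterminedBy H ↑T) :
    P.real (D ∩ H) ≤ regionFreeReal d p q Λ D * P.real H := by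
  have hDE := determinedBy_preimage_inter_edgeSet hDΛ
  have h := hP.le_free_mul_of_isLowerSet hp hq Λ T (isLowerSet_preimage_inter_edgeSet hD) hDE hDE.measurableSet_of_finset
    hT hH
  rwa [regionFreeReal_preimage_inter_edgeSet hp hq,
    measureReal_preimage_inter_edgeSet_inter hP.ae_subset_edgeSet] at h

/-- Decreasing event determined by all pairs of `Λ`, from below: `φ¹_{Λ,p,q}(D) · P(H) ≤ P(D ∩ H)`.
[cite: Grimmett2006, Lemma (4.13) and Lemma (4.14)(b)] -/
theorem wired_mul_le_of_isLowerSet_of_determinedBy_sym2 (hP : FKGibbs d p q P) (hp : p ∈ Set.Icc (0 : ℝ) 1)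
    (hq : 0 < q) (Λ : Finset (Site d)) {D H : Set (BondConfig (Site d))} (T : Finset (Sym2 (Site d)))
    (hD : IsLowerSet D) (hDΛ : DeterminedBy D ↑(Λ.sym2))
    (hT : Disjoint (↑T : Set (Sym2 (Site d))) ↑(edgesIn (zdGraph d) Λ)) (hH : DeterminedBy H ↑T) :
    regionWiredReal d p q Λ D * P.real H ≤ P.real (D ∩ H) := by
  have h := hP.wired_mul_le_of_isLowerSet hp hq Λ T (isLowerSet_preimage_inter_edgeSet hD)
    (determinedBy_preimage_inter_edgeSet hDΛ) hT hH
  rwa [regionWiredReal_preimage_inter_edgeSet hp hq,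
    measureReal_preimage_inter_edgeSet_inter hP.ae_subset_edgeSet] at h

/-! ### Extremality for events determined by all pairs of a region; the one-arm events -/

/-- `φ⁰_{p,q}(A) ≤ P(A)` for an increasing event determined by all pairs of a finite region, the free box limit
`P₀` being carried by lattice configurations (FO-06b `IsBoxLimit.ae_subset_edgeSet`).
[cite: Grimmett2006, Thm. (4.19)(c) eq. (4.21)] -/
theorem isBoxLimit_real_le_of_determinedBy_sym2 (hP : FKGibbs d p q P) (hP₀ : IsBoxLimit d false p q P₀)
    (h₀E : ∀ᵐ ω ∂P₀, ω ⊆ (zdGraph d).edgeSet) {A : Set (BondConfig (Site d))} {Λ : Finset (Site d)}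
    (hA : IsUpperSet A) (hAΛ : DeterminedBy A ↑(Λ.sym2)) : P₀.real A ≤ P.real A := by
  rw [← measureReal_preimage_inter_edgeSet h₀E A, ← measureReal_preimage_inter_edgeSet hP.ae_subset_edgeSet A]
  exact hP.isBoxLimit_real_le hP₀ (isUpperSet_preimage_inter_edgeSet hA) (determinedBy_preimage_inter_edgeSet hAΛ)

/-- `P(A) ≤ φ¹_{p,q}(A)` for an increasing event determined by all pairs of a finite region, the wired box limit
`P₁` being carried by lattice configurations. [cite: Grimmett2006, Thm. (4.19)(c) eq. (4.21)] -/
theorem real_le_isBoxLimit_of_determinedBy_sym2 (hP : FKGibbs d p q P) (hP₁ : IsBoxLimit d true p q P₁)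
    (h₁E : ∀ᵐ ω ∂P₁, ω ⊆ (zdGraph d).edgeSet) {A : Set (BondConfig (Site d))} {Λ : Finset (Site d)}
    (hA : IsUpperSet A) (hAΛ : DeterminedBy A ↑(Λ.sym2)) : P.real A ≤ P₁.real A := by
  rw [← measureReal_preimage_inter_edgeSet h₁E A, ← measureReal_preimage_inter_edgeSet hP.ae_subset_edgeSet A]
  exact hP.real_le_isBoxLimit hP₁ (isUpperSet_preimage_inter_edgeSet hA) (determinedBy_preimage_inter_edgeSet hAΛ)

/-- Decreasing events determined by all pairs of a region: `P(D) ≤ φ⁰_{p,q}(D)`.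
[cite: Grimmett2006, Thm. (4.19)(c) eq. (4.21)] -/
theorem real_le_isBoxLimit_of_isLowerSet_of_determinedBy_sym2 (hP : FKGibbs d p q P)
    (hP₀ : IsBoxLimit d false p q P₀) (h₀E : ∀ᵐ ω ∂P₀, ω ⊆ (zdGraph d).edgeSet) {D : Set (BondConfig (Site d))}
    {Λ : Finset (Site d)} (hD : IsLowerSet D) (hDΛ : DeterminedBy D ↑(Λ.sym2)) : P.real D ≤ P₀.real D := by
  rw [← measureReal_preimage_inter_edgeSet h₀E D, ← measureReal_preimage_inter_edgeSet hP.ae_subset_edgeSet D]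
  exact hP.real_le_isBoxLimit_of_isLowerSet hP₀ (isLowerSet_preimage_inter_edgeSet hD)
    (determinedBy_preimage_inter_edgeSet hDΛ)

/-- Decreasing events determined by all pairs of a region: `φ¹_{p,q}(D) ≤ P(D)`.
[cite: Grimmett2006, Thm. (4.19)(c) eq. (4.21)] -/
theorem isBoxLimit_real_le_of_isLowerSet_of_determinedBy_sym2 (hP : FKGibbs d p q P)
    (hP₁ : IsBoxLimit d true p q P₁) (h₁E : ∀ᵐ ω ∂P₁, ω ⊆ (zdGraph d).edgeSet) {D : Set (BondConfig (Site d))}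
    {Λ : Finset (Site d)} (hD : IsLowerSet D) (hDΛ : DeterminedBy D ↑(Λ.sym2)) : P₁.real D ≤ P.real D := by
  rw [← measureReal_preimage_inter_edgeSet h₁E D, ← measureReal_preimage_inter_edgeSet hP.ae_subset_edgeSet D]
  exact hP.isBoxLimit_real_le_of_isLowerSet hP₁ (isLowerSet_preimage_inter_edgeSet hD)
    (determinedBy_preimage_inter_edgeSet hDΛ)

/-- **`φ⁰_{p,q}(0 ↔ ∂Λ_n) ≤ P(0 ↔ ∂Λ_n)`** for every `P` of the sandwich class: the one-arm event
`siteToBoundary d n` is increasing and determined by the pairs of `Λ_n` (tree `DCT16`). Its `n → ∞` limits under the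
box limits are `θ⁰`, `θ¹` (Grimmett 2006, (5.1)–(5.3); FO-07). [cite: Grimmett2006, Thm. (4.19)(c) eq. (4.21)] -/
theorem isBoxLimit_real_siteToBoundary_le (hP : FKGibbs d p q P) (hP₀ : IsBoxLimit d false p q P₀)
    (h₀E : ∀ᵐ ω ∂P₀, ω ⊆ (zdGraph d).edgeSet) (n : ℕ) :
    P₀.real (siteToBoundary d n) ≤ P.real (siteToBoundary d n) :=
  hP.isBoxLimit_real_le_of_determinedBy_sym2 hP₀ h₀E (DCT16.isUpperSet_siteToBoundary d n)
    (DCT16.determinedBy_siteToBoundary d n)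

/-- **`P(0 ↔ ∂Λ_n) ≤ φ¹_{p,q}(0 ↔ ∂Λ_n)`** for every `P` of the sandwich class.
[cite: Grimmett2006, Thm. (4.19)(c) eq. (4.21)] -/
theorem real_siteToBoundary_le_isBoxLimit (hP : FKGibbs d p q P) (hP₁ : IsBoxLimit d true p q P₁)
    (h₁E : ∀ᵐ ω ∂P₁, ω ⊆ (zdGraph d).edgeSet) (n : ℕ) :
    P.real (siteToBoundary d n) ≤ P₁.real (siteToBoundary d n) :=
  hP.real_le_isBoxLimit_of_determinedBy_sym2 hP₁ h₁E (DCT16.isUpperSet_siteToBoundary d n)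
    (DCT16.determinedBy_siteToBoundary d n)

end FKGibbs

end Summit.CriticalPhenomena.PercolationContinuityZ3.Theorems.FK

end
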